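import Literature.NumberTheory.EllipticCurves.HasseWeilAbelianEulerFactorElliptic
import Literature.NumberTheory.EllipticCurves.TateModuleFixedPointsProofs
import HarnessLib

/-!
# Euler factors of an elliptic curve at the multiplicative places: the Frobenius action on
# `(V_ℓ E)^{I_𝔓}` from Serre–Tate's Lemma 2 on torsion points

Topic `NumberTheory/EllipticCurves`, sequel of `HasseWeilAbelianEulerFactorElliptic` (the
corrected Euler-factor fact `WeierstrassCurve.hasseWeilEulerFactor_geomPoints_of_isElliptic` and
its reduction to statements about the inertia invariants `(V_ℓ E)^{I_𝔓}`) and of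
`TateModuleFixedPointsProofs` (`(V_ℓ E)^{H} = V_ℓ(E(K̄)^{H})`).

That file leaves, besides the dimension form of Serre–Tate's Lemma 2
(`nonempty_fixedSubmodule_inertia_rationalTate_equiv_reductionPoints`,
`HasseWeilAbelianInertiaInvariants`), two named facts about the **rational Tate module**:
`smul_fixedSubmodule_inertia_rationalTate_of_hasSplitMultiplicativeReductionAt` (`D_𝔓` acts on
`(V_ℓ E)^{I_𝔓}` through `χ_ℓ` at a split multiplicative place) and
`frobenius_smul_fixedSubmodule_inertia_rationalTate_of_hasNonsplitMultiplicativeReductionAt` (an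
arithmetic Frobenius acts on `(V_ℓ E)^{I_𝔓}` as `-N v` at a non-split one).  Both are, in the
sources, read off **Serre–Tate's Lemma 2** (Serre–Tate, *Good reduction of abelian varieties*,
Ann. of Math. 88 (1968), §1, p. 495 = Œuvres II PDF p. 450): *"The reduction map defines an
isomorphism of `A_m^I` onto `Ã_m`.  This isomorphism commutes with the action of `D(v̄)`"* — a
statement about the **`m`-torsion points** fixed by inertia (`m` prime to `p`; `K` any field with
a discrete valuation `v`, `v̄` an extension to `K_s`, `I(v̄) ⊆ D(v̄)`, exactly the setting
`𝔓 ∣ v` of `HasseWeilAbelian`), together with Lemma 1 (*the index of `Ã⁰_m` in `Ã_m` divides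
`c = (Ã : Ã⁰)`*) and the structure of the torus `Ã⁰ = Ẽ_ns`: `≅ 𝔾_m` over `k_v` at a split node,
its quadratic twist at a non-split node (Silverman, *AEC*, Prop. III.2.5 and Exercise 3.5, PDF
pp. 59, 97; definition of split/non-split, VII.§5, PDF p. 174).  For elliptic curves the proof of
Lemma 2 is elementary (Silverman, *ATAEC*, proof of Thm. IV.10.2(a), PDF p. 359, "taken from
Serre–Tate": `E(K^nr) ⊇ E₀(K^nr) ↠ Ẽ_ns(k̄)` with kernel `E₁(K^nr)` uniquely `ℓ`-divisible,
*AEC* VII.2.1, VII.2.2, VII.3.1, and `E(K^nr)/E₀(K^nr)` finite of order `c`, Kodaira–Néron,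
*AEC* VII.6.1 / *ATAEC* IV.9.2(d)).

This file performs the passage **torsion points ⇒ Tate module ⇒ rational Tate module** once and
for all, so that what remains of the two facts is a statement about points of `E(K̄)`:

* `Literature.NumberTheory.EllipticCurves.TateModule.nsmul_smul_eq_nsmul_smul_of_forall_torsion`,
  `Literature.NumberTheory.EllipticCurves.RationalTateModule.rationalTateRepresentation_eq_smul_of_forall_torsion`
  (and `…_eq_neg_smul_of_forall_torsion`), for any abelian group `A` with an action of a group
  `G`, `H ≤ G`, `g ∈ G`, `u ∈ ℤ_p`, `c ≠ 0`: **if `g • (c • a) = (u mod pⁿ) • (c • a)` for every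
  `H`-fixed `a ∈ A[pⁿ]` and every `n`, then `g` acts on `(V_p A)^H` as the scalar `u`** (clear
  denominators, `FaltingsECSemisimpleProofs`; the lattice point is `H`-fixed since
  `T_p A ↪ V_p A`; compare components; cancel `c` in the `ℚ_p`-vector space);
* `WeierstrassCurve.serreTate_smul_torsion_of_hasSplitMultiplicativeReductionAt W ℓ`
  (**named fact**, Serre–Tate Lemmas 1–2 + split torus, on torsion points): at a split
  multiplicative place `v ∤ ℓ`, `𝔓 ∣ v`, there is `c ≠ 0` with
  `σ(c • P) = (χ_ℓ(σ) mod ℓⁿ) • (c • P)` for all `σ ∈ D_𝔓` and all `I_𝔓`-fixed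
  `P ∈ E(K̄)[ℓⁿ]`;
* `WeierstrassCurve.serreTate_frobenius_smul_torsion_of_hasNonsplitMultiplicativeReductionAt W ℓ`
  (**named fact**, Serre–Tate Lemmas 1–2 + non-split torus): at a non-split multiplicative place,
  `σ(c • P) = -(N v • (c • P))` for every arithmetic Frobenius `σ` at `𝔓` and all `I_𝔓`-fixed
  `P ∈ E(K̄)[ℓⁿ]`;
* (proved) `smul_fixedSubmodule_inertia_rationalTate_of_hasSplitMultiplicativeReductionAt_of_torsion`,
  `frobenius_smul_fixedSubmodule_inertia_rationalTate_of_hasNonsplitMultiplicativeReductionAt_of_torsion`: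
  the two `V_ℓ`-level facts of `HasseWeilAbelianEulerFactorElliptic` from the torsion-point
  facts; hence (proved) `hasseWeilEulerFactor_geomPoints_of_isElliptic_of_serreTate_of_torsion`:
  **the corrected Euler-factor fact `hasseWeilEulerFactor_geomPoints_of_isElliptic W ℓ` from the
  dimension form of Serre–Tate's Lemma 2 and its two equivariant torsion-point forms at the
  multiplicative places** (three leaves, all of them instances of Serre–Tate §1 Lemmas 1–2 for
  elliptic curves), with the codimension variant `…_of_codim_of_torsion` and the pointwise schema
  instance `hasseWeilEulerFactor_geomPoints_of_serreTate_of_torsion` for elliptic `W`.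

## Why the torsion-point facts hold (the printed proofs, for the record of the leaves)

Let `L = K̄^{I_𝔓}`, `O` its valuation ring at `𝔓`, residue field `k̄ = \bar ℤ_K/𝔓` (an algebraic
closure of `k_v`, with `D_𝔓` acting through `D_𝔓/I_𝔓 ≅ Gal(k̄/k_v)`), `Ẽ` the reduction of the
`v`-minimal model (a nodal cubic over `k_v`; `v(c₄) = 0`, so the model stays minimal over `L`).
`E(K̄)^{I_𝔓}[ℓⁿ] = E(L)[ℓⁿ]`; `c = (E(L) : E₀(L))` is finite (Kodaira–Néron over the completion
`\widehat{K_v^nr}`, *AEC* VII.6.1: cyclic of order `v(Δ_min)` at every multiplicative place, split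
or not, since over `K_v^nr` — residue field `k̄` — the node is split), so `c • P ∈ E₀(L)`;
reduction `r : E₀(L) → Ẽ_ns(k̄)` is a `D_𝔓`-equivariant
homomorphism (*AEC* VII.2.1) whose kernel `E₁(L)` has no `ℓ`-torsion (*AEC* VII.3.1), so `r` is
injective on `E₀(L)[ℓ^∞]` and it suffices to know `σ̄` on `Ẽ_ns(k̄)[ℓⁿ]`.  Split node (tangent
slopes `α₁ ≠ α₂` in `k_v`): `ψ : Ẽ_ns(k̄) ≅ k̄ˣ`, `(x, y) ↦ (y - α₁x - β₁)/(y - α₂x - β₂)` has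
coefficients in `k_v`, so commutes with `σ̄`, and `Ẽ_ns(k̄)[ℓⁿ] ≅ μ_{ℓⁿ}(k̄) = μ_{ℓⁿ}(K̄) mod 𝔓`
(injective reduction, `ℓ ∉ 𝔓`), on which `σ` acts by `χ_ℓ(σ) mod ℓⁿ`
(`GaloisRep.cyclotomicCharacter_spec`).  Non-split node (`α₁, α₂` conjugate over `k_v`), `σ` an
arithmetic Frobenius (`σ̄ = (x ↦ x^{N v})` on `\bar ℤ_K/𝔓`, Mathlib `IsArithFrobAt`): `σ̄` swaps
the two tangent lines, so `σ̄(ψ(P̃)) = ψ(σ̄ P̃)⁻¹`, i.e. `ψ(σ̄ P̃) = ψ(P̃)^{-N v}` and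
`σ̄ P̃ = -(N v • P̃)` (*AEC* Exercise 3.5(a)(ii); the tree's `NonsplitNode`).

## References

* J.-P. Serre, J. Tate, *Good reduction of abelian varieties*, Ann. of Math. (2) 88 (1968),
  492–517, §1 Lemma 1 and Lemma 2 (p. 495; Œuvres II no. 79, PDF pp. 449–450). [SerreTate1968]
* J. H. Silverman, *The Arithmetic of Elliptic Curves*, 2nd ed., GTM 106 (2009): Prop. III.2.5
  (PDF p. 59), Exercise 3.5 (PDF p. 97), VII.§5 definition (PDF p. 174), Thm. VII.6.1 (PDF
  p. 177), Props. VII.2.1, VII.3.1, C.§16 (PDF p. 390). [SilvermanAEC2009]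
* J. H. Silverman, *Advanced Topics in the Arithmetic of Elliptic Curves*, GTM 151 (1994): proof
  of Thm. IV.10.2(a) (PDF p. 359), Cor. IV.9.2(d), Exercise 5.13 (PDF p. 416). [SilvermanATAEC1994]

## Design

`noncomputable section`, one universe `u`; generic lemmas in
`namespace Literature.NumberTheory.EllipticCurves.{TateModule, RationalTateModule}` (arbitrary
`[AddCommGroup A]`, `[Group G] [DistribMulAction G A]`, the setting of `TateModuleFixedPointsProofs`);
the named facts are deliberate dot-notation extensions of Mathlib's `WeierstrassCurve` namespace
with the quantifier layout of the sibling facts (`∀ [W.IsElliptic] (v) (hℓ) (hv) {𝔓} (h𝔓), …`),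
`σ : D_𝔓` ranging over Mathlib's `Ideal.decompositionSubgroup` in the split fact and over the
arithmetic Frobenius elements (`IsArithFrobAt (𝓞 K) σ 𝔓`) in the non-split fact, exactly as in
the two `V_ℓ`-level facts they imply; `(χ_ℓ(σ) mod ℓⁿ) • P` is written
`((χ_ℓ(σ) : ℤ_[ℓ]).toZModPow n).val • P`, the form of Mathlib's `cyclotomicCharacter.spec` and of
the tree's `ℤ_[ℓ]`-action on `T_ℓ` (`TateModule.proj_smul`).  No instances, no `sorry`; the only
`def`s are the two named facts.
-/

noncomputable section

open Module

universe u

namespace Literature.NumberTheory.EllipticCurves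

/-! ### From torsion points to the Tate module: a scalar action detected on `A[p^∞]^H` -/

namespace TateModule

variable {A : Type u} [AddCommGroup A] {p : ℕ} [Fact p.Prime]
variable {G : Type*} [Group G] [DistribMulAction G A]

omit [Fact p.Prime] in
/-- The components of an `H`-fixed element of `T_p A` are `H`-fixed points of `A`. [folklore] -/
theorem smul_proj_eq_of_forall_smul_eq (H : Subgroup G) {x : TateModule A p}
    (hx : ∀ h ∈ H, h • x = x) (n : ℕ) : ∀ h ∈ H, h • proj p n x = proj p n x := fun h hh ↦ by
  rw [← proj_smul_of_distribMulAction, hx h hh]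

/-- **A scalar action read off the torsion points.**  Let `H ≤ G`, `g ∈ G`, `u ∈ ℤ_p` and
`c ≠ 0`; suppose that for every `n` and every `H`-fixed point `a ∈ A` with `p ^ n • a = 0` one has
`g • (c • a) = (u mod p ^ n) • (c • a)`.  Then `c • (g • x) = c • (u • x)` for every `H`-fixed
`x ∈ T_p A` (componentwise: `x_n` is an `H`-fixed point of `A[p^n]`). [folklore] -/
theorem nsmul_smul_eq_nsmul_smul_of_forall_torsion (H : Subgroup G) (g : G) (u : ℤ_[p]) (c : ℕ)
    (hyp : ∀ (n : ℕ) (a : A), (∀ h ∈ H, h • a = a) → p ^ n • a = 0 →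
      g • (c • a) = (PadicInt.toZModPow n u).val • (c • a))
    {x : TateModule A p} (hx : ∀ h ∈ H, h • x = x) :
    c • (g • x) = c • (u • x) := by
  refine TateModule.ext fun n ↦ ?_
  rw [map_nsmul, map_nsmul, proj_smul_of_distribMulAction, proj_smul, ← smul_comm g c,
    hyp n (proj p n x) (smul_proj_eq_of_forall_smul_eq H hx n) (pow_smul_proj n x), smul_comm]

end TateModule

namespace RationalTateModule

variable {A : Type u} [AddCommGroup A] {p : ℕ} [Fact p.Prime]
variable {G : Type*} [Group G] [DistribMulAction G A]

/-- **A scalar action on `(V_p A)^H` read off the torsion points** (the Tate-module algebra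
behind Serre–Tate's Lemma 2 ⇒ Frobenius eigenvalues).  Let `H ≤ G`, `g ∈ G`, `u ∈ ℤ_p` and
`c ≠ 0`; suppose that for every `n` and every `H`-fixed `a ∈ A` with `p ^ n • a = 0` one has
`g • (c • a) = (u mod p ^ n) • (c • a)`.  Then `g` acts on the `H`-invariants of `V_p A` as the
scalar `u`: clear denominators (`exists_smul_eq_toRational`), note that the lattice point is
`H`-fixed (`T_p A ↪ V_p A`), compare components (`TateModule.nsmul_smul_eq_nsmul_smul_of_forall_torsion`)
and cancel `c` in the `ℚ_p`-vector space `V_p A`. [folklore] -/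
theorem rationalTateRepresentation_eq_smul_of_forall_torsion (H : Subgroup G) (g : G)
    (u : ℤ_[p]) {c : ℕ} (hc : c ≠ 0)
    (hyp : ∀ (n : ℕ) (a : A), (∀ h ∈ H, h • a = a) → p ^ n • a = 0 →
      g • (c • a) = (PadicInt.toZModPow n u).val • (c • a))
    {v : RationalTateModule A p} (hv : ∀ h ∈ H, rationalTateRepresentation G A p h v = v) :
    rationalTateRepresentation G A p g v = (u : ℚ_[p]) • v := by
  obtain ⟨N, hN, x, hx⟩ := RationalTateModule.exists_smul_eq_toRational v
  have hN' : (N : ℚ_[p]) ≠ 0 := PadicInt.coe_ne_zero.mpr hN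
  have hxfix : ∀ h ∈ H, h • x = x := fun h hh ↦ by
    apply TateModule.toRational_injective
    rw [← rationalTateRepresentation_toRational, ← hx, LinearMap.map_smul_of_tower, hv h hh]
  have hT : TateModule.toRational p (g • x) = TateModule.toRational p (u • x) := by
    have := congrArg (TateModule.toRational p)
      (TateModule.nsmul_smul_eq_nsmul_smul_of_forall_torsion H g u c hyp hxfix)
    rw [map_nsmul, map_nsmul, ← Nat.cast_smul_eq_nsmul ℚ_[p], ← Nat.cast_smul_eq_nsmul ℚ_[p]]
      at this
    exact smul_right_injective _ (Nat.cast_ne_zero.mpr hc) this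
  have hv' : v = (N : ℚ_[p])⁻¹ • TateModule.toRational p x := by
    rw [← hx, smul_smul, inv_mul_cancel₀ hN', one_smul]
  rw [hv', LinearMap.map_smul, rationalTateRepresentation_toRational, hT, LinearMap.map_smul,
    ← algebraMap_smul ℚ_[p] u (TateModule.toRational p x), PadicInt.algebraMap_apply, smul_comm]

/-- Variant with an eigenvalue `-q`, `q ∈ ℕ` (the shape at a non-split multiplicative place,
where an arithmetic Frobenius acts on the torsion of the reduction as `-N v`): if
`g • (c • a) = -(q • (c • a))` for all `H`-fixed `a ∈ A[p^n]` and all `n`, then `g` acts on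
`(V_p A)^H` as `-q`. [folklore] -/
theorem rationalTateRepresentation_eq_neg_smul_of_forall_torsion (H : Subgroup G) (g : G)
    (q : ℕ) {c : ℕ} (hc : c ≠ 0)
    (hyp : ∀ (n : ℕ) (a : A), (∀ h ∈ H, h • a = a) → p ^ n • a = 0 →
      g • (c • a) = -(q • (c • a)))
    {v : RationalTateModule A p} (hv : ∀ h ∈ H, rationalTateRepresentation G A p h v = v) :
    rationalTateRepresentation G A p g v = -((q : ℚ_[p]) • v) := by
  have key := rationalTateRepresentation_eq_smul_of_forall_torsion H g (-(q : ℤ_[p])) hc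
    (fun n a ha hn ↦ ?_) hv
  · rw [key, PadicInt.coe_neg, PadicInt.coe_natCast, neg_smul]
  · -- `(-q mod p^n) • b = -(q • b)` for `b = c • a ∈ A[p^n]`
    rw [hyp n a ha hn]
    set b := c • a with hb
    have hbn : p ^ n • b = 0 := by rw [hb, smul_comm, hn, smul_zero]
    have hdvd : p ^ n ∣ (PadicInt.toZModPow n (-(q : ℤ_[p]))).val + q := by
      rw [← ZMod.natCast_eq_zero_iff, Nat.cast_add, ZMod.natCast_zmod_val, map_neg,
        map_natCast, neg_add_cancel]
    obtain ⟨t, ht⟩ := hdvd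
    have h0 : ((PadicInt.toZModPow n (-(q : ℤ_[p]))).val + q) • b = 0 := by
      rw [ht, mul_comm, mul_smul, hbn, smul_zero]
    rw [add_smul] at h0
    exact neg_eq_of_add_eq_zero_left h0

end RationalTateModule

end Literature.NumberTheory.EllipticCurves

namespace WeierstrassCurve

open Literature.NumberTheory.EllipticCurves Literature.NumberTheory.GaloisRepresentations
open scoped NumberField
open Field IsDedekindDomain

variable {K : Type u} [Field K] [NumberField K] (W : WeierstrassCurve K) (ℓ : ℕ) [Fact ℓ.Prime]

/-! ### Serre–Tate's Lemma 2 at the multiplicative places, on torsion points (named facts) -/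

section Facts

/-- **Serre–Tate's Lemma 2 at a split multiplicative place, on torsion points: `D_𝔓` acts on
`c • E(K̄)^{I_𝔓}[ℓⁿ]` through the cyclotomic character.**  For an elliptic curve `E/K` over a
number field with split multiplicative reduction at the finite place `v ∤ ℓ` and a prime `𝔓 ∣ v`
of `\bar ℤ_K`, there is an integer `c ≠ 0` such that for every `σ` in the decomposition group
`D_𝔓`, every `n` and every point `P ∈ E(K̄)` fixed by the inertia group `I_𝔓` with
`ℓⁿ P = O`: `σ(cP) = [χ_ℓ(σ) mod ℓⁿ](cP)`.  Printed sources: Serre–Tate, §1 Lemma 2, *"The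
reduction map defines an isomorphism of `A_m^I` onto `Ã_m`.  This isomorphism commutes with the
action of `D(v̄)`"* (`m` prime to `p`, `A_m^I` the `I(v̄)`-invariant `m`-torsion points, `Ã`
the special fibre of the Néron model), with Lemma 1 (*the index of `Ã⁰_m` in `Ã_m` divides
`c = (Ã : Ã⁰)`*, so `c • Ã_m ⊆ Ã⁰_m`); for an elliptic curve with split multiplicative reduction
`Ã⁰ = Ẽ_ns ≅ 𝔾_m` over `k_v` (Silverman, *AEC*, Prop. III.2.5(a) and Exercise 3.5(a)(i): the
isomorphism `(x, y) ↦ (y - α₁x - β₁)/(y - α₂x - β₂)` is defined over `k_v` when the tangent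
slopes are, which is the definition of *split*, VII.§5), so `Ã⁰_{ℓⁿ} = μ_{ℓⁿ}(k̄_v)`, on which
`D_𝔓` acts through `χ_ℓ` (reduction mod `𝔓` is injective on `μ_{ℓⁿ}(K̄)`, `ℓ ∉ 𝔓`); and
`c = (E(K_v^nr) : E₀(K_v^nr)) = v(Δ_min)` by Kodaira–Néron (*AEC* Thm. VII.6.1).  Equivalently
Silverman, *ATAEC*, Exercise 5.13(a),(b): `T_ℓ(E)^{I} = T_ℓ(μ)` as a `G_K`-module (by (b) the
inertia group acts non-trivially, so the invariants are exactly `T_ℓ(μ)`).  (Consequence,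
`smul_fixedSubmodule_inertia_rationalTate_of_hasSplitMultiplicativeReductionAt_of_torsion`: `D_𝔓`
acts on `(V_ℓ E)^{I_𝔓}` through `χ_ℓ`.)
[cite: SerreTate1968, §1 Lemma 1 and Lemma 2 (p. 495)]
[cite: SilvermanAEC2009, Prop. III.2.5(a), Exercise 3.5(a)(i), Thm. VII.6.1 (PDF pp. 59, 97, 177)] -/
def serreTate_smul_torsion_of_hasSplitMultiplicativeReductionAt : Prop :=
  ∀ [W.IsElliptic] (v : HeightOneSpectrum (𝓞 K)) (_hℓ : (ℓ : 𝓞 K) ∉ v.asIdeal)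
    (_hv : W.HasSplitMultiplicativeReductionAt v)
    {𝔓 : Ideal (absIntegers (𝓞 K) K)} (_h𝔓 : 𝔓 ∈ v.primesAbove),
    ∃ c : ℕ, c ≠ 0 ∧
      ∀ (σ : 𝔓.decompositionSubgroup (absoluteGaloisGroup K)) (n : ℕ) (P : geomPoints W),
        (∀ τ ∈ 𝔓.inertia (absoluteGaloisGroup K), τ • P = P) → ℓ ^ n • P = 0 →
        (σ : absoluteGaloisGroup K) • (c • P) =
          (((GaloisRep.cyclotomicCharacter K ℓ (σ : absoluteGaloisGroup K) : ℤ_[ℓ]ˣ) :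
            ℤ_[ℓ]).toZModPow n).val • (c • P)

/-- **Serre–Tate's Lemma 2 at a non-split multiplicative place, on torsion points: an arithmetic
Frobenius acts on `c • E(K̄)^{I_𝔓}[ℓⁿ]` as `-N v`.**  For an elliptic curve `E/K` over a number
field with non-split multiplicative reduction at the finite place `v ∤ ℓ`
(`W.HasMultiplicativeReductionAt v` and not `W.HasSplitMultiplicativeReductionAt v`) and a prime
`𝔓 ∣ v` of `\bar ℤ_K`, there is an integer `c ≠ 0` such that for every arithmetic Frobenius
`σ ∈ Γ_K` at `𝔓` (Mathlib `IsArithFrobAt`: `σ x ≡ x^{N v} mod 𝔓`), every `n` and every point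
`P ∈ E(K̄)` fixed by `I_𝔓` with `ℓⁿ P = O`: `σ(cP) = -[N v](cP)`.  Printed sources: Serre–Tate,
§1 Lemma 2 (the reduction isomorphism `A_m^I ≅ Ã_m` commutes with `D(v̄)`) and Lemma 1
(`c • Ã_m ⊆ Ã⁰_m`, `c = (Ã : Ã⁰)`), with the non-split torus `Ã⁰ = Ẽ_ns`: the tangent slopes
`α₁, α₂` at the node are conjugate over `k_v` (Silverman, *AEC*, VII.§5; Exercise 3.5(a)(ii):
`Ẽ_ns(k_v) ≅ {t ∈ k_v(α₁)^* : N(t) = 1}`), the `N v`-power Frobenius `σ̄` swaps the two tangent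
lines, so `ψ(σ̄ P̃) = σ̄(ψ P̃)⁻¹ = ψ(P̃)^{-N v}` for `ψ = (y - α₁x - β₁)/(y - α₂x - β₂)`
(Prop. III.2.5(a)), i.e. `σ̄ = -N v` on `Ẽ_ns(k̄_v)[ℓⁿ]`; and
`c = (E(K_v^nr) : E₀(K_v^nr)) = v(Δ_min)` by Kodaira–Néron (*AEC* Thm. VII.6.1; over `K_v^nr` the
node is split).  Equivalently Silverman, *ATAEC*, Thm. V.5.3 with Lemma V.5.2(c), Exercises
5.11(b), 5.13(a),(b): `T_ℓ(E)^{I} = T_ℓ(μ) ⊗ χ`, `χ` the unramified quadratic character.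
(Consequence,
`frobenius_smul_fixedSubmodule_inertia_rationalTate_of_hasNonsplitMultiplicativeReductionAt_of_torsion`:
`σ` acts on `(V_ℓ E)^{I_𝔓}` as `-N v`.)
[cite: SerreTate1968, §1 Lemma 1 and Lemma 2 (p. 495)]
[cite: SilvermanAEC2009, Prop. III.2.5(a), Exercise 3.5(a)(ii), Thm. VII.6.1 (PDF pp. 59, 97, 177)] -/
def serreTate_frobenius_smul_torsion_of_hasNonsplitMultiplicativeReductionAt : Prop :=
  ∀ [W.IsElliptic] (v : HeightOneSpectrum (𝓞 K)) (_hℓ : (ℓ : 𝓞 K) ∉ v.asIdeal)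
    (_hv : W.HasMultiplicativeReductionAt v) (_hns : ¬ W.HasSplitMultiplicativeReductionAt v)
    {𝔓 : Ideal (absIntegers (𝓞 K) K)} (_h𝔓 : 𝔓 ∈ v.primesAbove),
    ∃ c : ℕ, c ≠ 0 ∧
      ∀ ⦃σ : absoluteGaloisGroup K⦄ (_hσ : IsArithFrobAt (𝓞 K) σ 𝔓) (n : ℕ) (P : geomPoints W),
        (∀ τ ∈ 𝔓.inertia (absoluteGaloisGroup K), τ • P = P) → ℓ ^ n • P = 0 →
        σ • (c • P) = -(v.residueCard • (c • P))

end Facts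

/-! ### The Frobenius action on `(V_ℓ E)^{I_𝔓}` from the torsion-point facts -/

section Derivations

/-- **`D_𝔓` acts on `(V_ℓ E)^{I_𝔓}` through `χ_ℓ` at a split multiplicative place**, from the
torsion-point form of Serre–Tate's Lemma 2: the named fact
`smul_fixedSubmodule_inertia_rationalTate_of_hasSplitMultiplicativeReductionAt W ℓ` of
`HasseWeilAbelianEulerFactorElliptic` follows from
`serreTate_smul_torsion_of_hasSplitMultiplicativeReductionAt W ℓ` by
`RationalTateModule.rationalTateRepresentation_eq_smul_of_forall_torsion` (with `H = I_𝔓`,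
`u = χ_ℓ(σ)`).  Silverman, *ATAEC*, Exercise 5.13(a),(b): `(V_ℓ E)^{I} = V_ℓ(μ)`.
[cite: SerreTate1968, §1 Lemma 2] [cite: SilvermanATAEC1994, Exercise 5.13(a),(b) (PDF p. 416)] -/
theorem smul_fixedSubmodule_inertia_rationalTate_of_hasSplitMultiplicativeReductionAt_of_torsion
    (hB : W.serreTate_smul_torsion_of_hasSplitMultiplicativeReductionAt ℓ) :
    W.smul_fixedSubmodule_inertia_rationalTate_of_hasSplitMultiplicativeReductionAt ℓ := by
  intro _ h v hℓ hv 𝔓 h𝔓 σ e he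
  obtain ⟨c, hc, hyp⟩ := hB v hℓ hv h𝔓
  rw [ContinuousRep.mem_fixedSubmodule] at he
  exact RationalTateModule.rationalTateRepresentation_eq_smul_of_forall_torsion
    (𝔓.inertia (absoluteGaloisGroup K)) (σ : absoluteGaloisGroup K) _ hc
    (fun n a ha hn ↦ hyp σ n a ha hn) he

/-- **An arithmetic Frobenius acts on `(V_ℓ E)^{I_𝔓}` as `-N v` at a non-split multiplicative
place**, from the torsion-point form of Serre–Tate's Lemma 2: the named fact
`frobenius_smul_fixedSubmodule_inertia_rationalTate_of_hasNonsplitMultiplicativeReductionAt W ℓ`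
of `HasseWeilAbelianEulerFactorElliptic` follows from
`serreTate_frobenius_smul_torsion_of_hasNonsplitMultiplicativeReductionAt W ℓ` by
`RationalTateModule.rationalTateRepresentation_eq_neg_smul_of_forall_torsion` (with `H = I_𝔓`,
`u = -N v`).  Silverman, *ATAEC*, Thm. V.5.3 and Exercises 5.11(b), 5.13(a),(b):
`(V_ℓ E)^{I} = V_ℓ(μ) ⊗ χ`.
[cite: SerreTate1968, §1 Lemma 2] [cite: SilvermanATAEC1994, Thm. V.5.3, Exercises 5.11(b), 5.13(a),(b) (PDF pp. 407, 416)] -/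
theorem frobenius_smul_fixedSubmodule_inertia_rationalTate_of_hasNonsplitMultiplicativeReductionAt_of_torsion
    (hC : W.serreTate_frobenius_smul_torsion_of_hasNonsplitMultiplicativeReductionAt ℓ) :
    W.frobenius_smul_fixedSubmodule_inertia_rationalTate_of_hasNonsplitMultiplicativeReductionAt
      ℓ := by
  intro _ h v hℓ hv hns 𝔓 h𝔓 σ hσ e he
  obtain ⟨c, hc, hyp⟩ := hC v hℓ hv hns h𝔓
  rw [ContinuousRep.mem_fixedSubmodule] at he
  exact RationalTateModule.rationalTateRepresentation_eq_neg_smul_of_forall_torsion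
    (𝔓.inertia (absoluteGaloisGroup K)) σ v.residueCard hc
    (fun n a ha hn ↦ hyp hσ n a ha hn) he

end Derivations

/-! ### Assembly: the corrected Euler-factor fact from Serre–Tate's Lemma 2 -/

section EulerFactor

/-- **The corrected Euler-factor fact from Serre–Tate's Lemma 2 (three leaves).**
`hasseWeilEulerFactor_geomPoints_of_isElliptic W ℓ` — for elliptic `W`, every prime `ℓ` and
every finite place `v ∤ ℓ`, `det(1 - σ_v T ∣ (V_ℓ E)_{I_v}) = L_v(E, T)` (Silverman, *AEC*,
C.§16) — follows from the dimension form of Serre–Tate's Lemma 2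
(`nonempty_fixedSubmodule_inertia_rationalTate_equiv_reductionPoints W ℓ`,
`HasseWeilAbelianInertiaInvariants`: `(V_ℓ E)^{I_𝔓} ≅ V_ℓ(Ẽ_ns(k̄_v))`) and its two equivariant
torsion-point forms at the multiplicative places
(`serreTate_smul_torsion_of_hasSplitMultiplicativeReductionAt W ℓ`,
`serreTate_frobenius_smul_torsion_of_hasNonsplitMultiplicativeReductionAt W ℓ`), everything else
(good places, `det ρ_{E,ℓ} = χ_ℓ`, unipotent inertia, invariants versus coinvariants, torsion
versus Tate module, Mathlib's `localPolynomial` by reduction type) being proved in the tree.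
[cite: SerreTate1968, §1 Lemma 2, §2 Thm. 3] [cite: SilvermanAEC2009, §C.16 (PDF p. 390)] -/
theorem hasseWeilEulerFactor_geomPoints_of_isElliptic_of_serreTate_of_torsion
    (hST : W.nonempty_fixedSubmodule_inertia_rationalTate_equiv_reductionPoints ℓ)
    (hB : W.serreTate_smul_torsion_of_hasSplitMultiplicativeReductionAt ℓ)
    (hC : W.serreTate_frobenius_smul_torsion_of_hasNonsplitMultiplicativeReductionAt ℓ) :
    W.hasseWeilEulerFactor_geomPoints_of_isElliptic ℓ :=
  W.hasseWeilEulerFactor_geomPoints_of_isElliptic_of_serreTate_of_frobenius ℓ hST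
    (W.smul_fixedSubmodule_inertia_rationalTate_of_hasSplitMultiplicativeReductionAt_of_torsion
      ℓ hB)
    (W.frobenius_smul_fixedSubmodule_inertia_rationalTate_of_hasNonsplitMultiplicativeReductionAt_of_torsion
      ℓ hC)

/-- Variant: the corrected Euler-factor fact from the two bad-place cases of Silverman *ATAEC*
Thm. IV.10.2(a) (`codim (V_ℓ E)^{I_𝔓} = 1`, `= 2` at the multiplicative, additive places;
`HasseWeilAbelianConductor`) and the two torsion-point facts.
[cite: SilvermanATAEC1994, Thm. IV.10.2(a) (PDF p. 358)] [cite: SerreTate1968, §1 Lemma 2] -/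
theorem hasseWeilEulerFactor_geomPoints_of_isElliptic_of_codim_of_torsion
    (hTm : W.codimFixed_inertia_rationalTate_eq_one_of_hasMultiplicativeReductionAt ℓ)
    (hTa : W.codimFixed_inertia_rationalTate_eq_two_of_hasAdditiveReductionAt ℓ)
    (hB : W.serreTate_smul_torsion_of_hasSplitMultiplicativeReductionAt ℓ)
    (hC : W.serreTate_frobenius_smul_torsion_of_hasNonsplitMultiplicativeReductionAt ℓ) :
    W.hasseWeilEulerFactor_geomPoints_of_isElliptic ℓ :=
  W.hasseWeilEulerFactor_geomPoints_of_isElliptic_of_codim_of_frobenius ℓ hTm hTa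
    (W.smul_fixedSubmodule_inertia_rationalTate_of_hasSplitMultiplicativeReductionAt_of_torsion
      ℓ hB)
    (W.frobenius_smul_fixedSubmodule_inertia_rationalTate_of_hasNonsplitMultiplicativeReductionAt_of_torsion
      ℓ hC)

/-- Pointwise form for an elliptic `W`: the schema instance `hasseWeilEulerFactor_geomPoints W ℓ`
(the form consumed by `hasRationalEulerFactors_geomPoints_iff`, Knapp 11.67, lang.S28) from the
three Serre–Tate leaves. [folklore] -/
theorem hasseWeilEulerFactor_geomPoints_of_serreTate_of_torsion [W.IsElliptic]
    (hST : W.nonempty_fixedSubmodule_inertia_rationalTate_equiv_reductionPoints ℓ)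
    (hB : W.serreTate_smul_torsion_of_hasSplitMultiplicativeReductionAt ℓ)
    (hC : W.serreTate_frobenius_smul_torsion_of_hasNonsplitMultiplicativeReductionAt ℓ) :
    W.hasseWeilEulerFactor_geomPoints ℓ :=
  W.hasseWeilEulerFactor_geomPoints_of_of_isElliptic ℓ
    (W.hasseWeilEulerFactor_geomPoints_of_isElliptic_of_serreTate_of_torsion ℓ hST hB hC)

end EulerFactor

end WeierstrassCurve

end
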